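import Summits.Schanuel.Schanuel.Theorems.ZilberEacGrowthDensity
import Literature.ModelTheory.Zilber.EACDensityOscillatory
import HarnessLib

/-!
# Zariski-non-generic sequences on a surface satisfy a two-variable relation; density from rotation

Zilber's Exponential-Algebraic Closedness, case ladder (host summit Schanuel, cell `pub-schanuel`,
seat 2, gen 5).  The structural half of THEOREM G (`ZilberEacGrowthDensity`) isolated and
strengthened, so that OTHER analytic endgames — in particular seat 1's oscillatory elimination
(`EACDensityOscillatory`: `eq_zero_of_eval₂_eq_zero_of_rotation`, `tendsto_norm_leadingCoeff_eval`,
`clusterIn_roots_of_tendsto`) — apply to ARBITRARY irreducible surfaces and to polynomials in all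
`2n` variables, not only to graph surfaces `{x₁ = p(x₀), y₀ = q(y₁)}` with their built-in
parametrisation `ℂ[z][w]`.

* THEOREM H (`exists_polyPoly_relation_of_forall_aeval_eq_zero`): `S ⊆ ℂⁿ × ℂⁿ` irreducible closed,
  `dim S ≤ 2`, `p₀, p₁, … ∈ S`, and `f ∉ I(S)` with `f(p_m) = 0` for ALL `m`.  Then for ANY two
  coordinates `a, b` there is a nonzero `H ∈ ℂ[s][t]` with `H(p_m(a))(p_m(b)) = 0` for all `m`.
  Proof: the closure of `{p_m}` has finitely many components `Z(Q)`, `Q` the minimal primes over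
  `I({p_m})`; each `Q ⊋ I(S)` has `dim ℂ[X]/Q ≤ 1`, so ANY two elements of the domain `ℂ[X]/Q` are
  algebraically dependent (`exists_polyPoly_relation_of_trdeg_le_one`); multiply the relations over
  the components (every `p_m` lies on one of them: a product of witnesses would otherwise be a
  polynomial in `√I({p_m})` not vanishing at `p_m`).  No subsequence is taken — this is what makes
  endgames that use the arithmetic of the FULL sequence (differences, rotations) available.
* THEOREM G′ (`unprojectedDense_of_not_clusterIn`, `unprojectedDense_of_rotation`): exponential
  points `p_m` of `S` with `‖x_{j₀}(p_m)‖ → ∞`, `‖y_{j₀}(p_m)‖` bounded, and `y_{j₀}(p_m)` NOT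
  clustering in any finite set (e.g. some multiplicative difference of it is a non-periodic rotation
  `c₀ ζ^m`, seat 1's hypothesis set) are Zariski dense in `S`.

HONEST FRAMING: general sufficient conditions for instances of an OPEN question; `EC(3,2)` OPEN;
nothing here bears on Schanuel's conjecture.
-/

noncomputable section

open MvPolynomial Filter
open Literature.NumberTheory.Transcendental Literature.ModelTheory.Zilber

set_option linter.dupNamespace false

namespace Summit.Schanuel.Schanuel.Theorems

/-! ## Any two elements of a domain of transcendence degree `≤ 1` are algebraically dependent -/

section Algebra

universe u_1
variable {K : Type u_1} [CommRing K] [Algebra ℂ K]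

/-- In a `ℂ`-domain of transcendence degree `≤ 1`, any `u, v` satisfy `H(u)(v) = 0` for some nonzero
`H ∈ ℂ[s][t]`. [folklore] -/
theorem exists_polyPoly_relation_of_trdeg_le_one [FaithfulSMul ℂ K] (h1 : Algebra.trdeg ℂ K ≤ 1)
    (u v : K) :
    ∃ H : Polynomial (Polynomial ℂ), H ≠ 0 ∧
      (Polynomial.eval₂RingHom (Polynomial.eval₂RingHom (algebraMap ℂ K) u) v) H = 0 := by
  by_cases hu : Transcendental ℂ u
  · exact exists_polyPoly_relation (isAlgebraic_adjoin_of_trdeg_le_one h1 hu v)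
  · -- `u` algebraic: a relation in `u` alone
    rw [Transcendental, not_not] at hu
    obtain ⟨r, hr0, hru⟩ := hu
    refine ⟨Polynomial.C r, Polynomial.C_ne_zero.2 hr0, ?_⟩
    rw [Polynomial.coe_eval₂RingHom, Polynomial.eval₂_C, Polynomial.coe_eval₂RingHom,
      ← Polynomial.aeval_def]
    exact hru

end Algebra

/-! ## Theorem H: a two-variable relation along a Zariski-non-generic sequence -/

section Relation

variable {n : ℕ}

/-- **Evaluation at a point of `Z(J)`** of a relation `H(ā)(b̄) = 0` holding in `ℂ[X]/J`. [folklore] -/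
theorem polyPoly_eval_eq_zero_of_mem_zeroLocus {J : Ideal (MvPolynomial (Fin n ⊕ Fin n) ℂ)}
    (a b : Fin n ⊕ Fin n) {H : Polynomial (Polynomial ℂ)}
    (hH : (Polynomial.eval₂RingHom (Polynomial.eval₂RingHom
        (algebraMap ℂ (MvPolynomial (Fin n ⊕ Fin n) ℂ ⧸ J))
        (Ideal.Quotient.mk _ (X a))) (Ideal.Quotient.mk _ (X b))) H = 0)
    {q : Fin n ⊕ Fin n → ℂ} (hq : q ∈ zeroLocus ℂ J) :
    (H.map (Polynomial.evalRingHom (q a))).eval (q b) = 0 := by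
  have hkill : ∀ g ∈ J, aeval q g = 0 := (mem_zeroLocus_iff.1 hq)
  let ψ : (MvPolynomial (Fin n ⊕ Fin n) ℂ ⧸ J) →ₐ[ℂ] ℂ := Ideal.Quotient.liftₐ J (aeval q) hkill
  have hψX : ∀ j, ψ (Ideal.Quotient.mk J (X j)) = q j := fun j => by
    change Ideal.Quotient.liftₐ J (aeval q) hkill (Ideal.Quotient.mk J (X j)) = q j
    rw [Ideal.Quotient.liftₐ_apply, Ideal.Quotient.lift_mk, RingHom.coe_coe, MvPolynomial.aeval_X]
  have h := congrArg ψ hH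
  rw [map_zero, Polynomial.coe_eval₂RingHom, ← AlgHom.coe_toRingHom, Polynomial.hom_eval₂,
    AlgHom.coe_toRingHom, hψX] at h
  have hcomp : (ψ : _ →+* ℂ).comp (Polynomial.eval₂RingHom (algebraMap ℂ _)
      (Ideal.Quotient.mk J (X a))) = Polynomial.evalRingHom (q a) := by
    refine Polynomial.ringHom_ext (fun c => ?_) ?_
    · rw [RingHom.comp_apply, Polynomial.coe_eval₂RingHom, Polynomial.eval₂_C, RingHom.coe_coe,
        AlgHom.commutes, Polynomial.coe_evalRingHom, Polynomial.eval_C, Algebra.algebraMap_self,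
        RingHom.id_apply]
    · rw [RingHom.comp_apply, Polynomial.coe_eval₂RingHom, Polynomial.eval₂_X, RingHom.coe_coe, hψX,
        Polynomial.coe_evalRingHom, Polynomial.eval_X]
  rw [hcomp, ← Polynomial.eval_map] at h
  exact h

/-- **A point of `Z(I)` lies on `Z(Q)` for some minimal prime `Q` over `I`** (Noetherian ring: finitely
many minimal primes, and `√I` is their intersection). [folklore] -/
theorem exists_minimalPrime_mem_zeroLocus {I : Ideal (MvPolynomial (Fin n ⊕ Fin n) ℂ)}
    {q : Fin n ⊕ Fin n → ℂ} (hq : q ∈ zeroLocus ℂ I) :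
    ∃ Q ∈ I.minimalPrimes, q ∈ zeroLocus ℂ Q := by
  classical
  have hfin := Ideal.finite_minimalPrimes_of_isNoetherianRing (MvPolynomial (Fin n ⊕ Fin n) ℂ) I
  by_contra hcon
  push Not at hcon
  -- for each minimal prime pick a member not vanishing at `q`
  have hpick : ∀ Q : Ideal (MvPolynomial (Fin n ⊕ Fin n) ℂ), Q ∈ I.minimalPrimes →
      ∃ g ∈ Q, aeval q g ≠ 0 := by
    intro Q hQ
    have := hcon Q hQ
    rw [mem_zeroLocus_iff] at this
    push Not at this
    exact this
  choose! g hgQ hgq using hpick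
  set G := ∏ Q ∈ hfin.toFinset, g Q with hG
  have hGrad : G ∈ I.radical := by
    rw [← Ideal.sInf_minimalPrimes, Submodule.mem_sInf]
    intro Q hQ
    have hQ' : Q ∈ hfin.toFinset := hfin.mem_toFinset.2 hQ
    rw [hG, ← Finset.mul_prod_erase _ _ hQ']
    exact Ideal.mul_mem_right _ _ (hgQ Q hQ)
  obtain ⟨k, hk⟩ := hGrad
  have h0 : aeval q (G ^ k) = 0 := (mem_zeroLocus_iff.1 hq) _ hk
  rw [map_pow] at h0
  have hG0 : aeval q G ≠ 0 := by
    rw [hG, map_prod]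
    exact Finset.prod_ne_zero_iff.2 fun Q hQ => hgq Q (hfin.mem_toFinset.1 hQ)
  exact hG0 (pow_eq_zero_iff'.1 h0).1

/-- **Theorem H (two-variable relation along a Zariski-non-generic sequence).**  Let `S` be
irreducible closed with `dim S ≤ 2`, `p₀, p₁, … ∈ S`, and `f ∉ I(S)` with `f(p_m) = 0` for all `m`.
Then for any coordinates `a, b` some nonzero `H ∈ ℂ[s][t]` has `H(p_m(a))(p_m(b)) = 0` for ALL `m`.
[folklore] -/
theorem exists_polyPoly_relation_of_forall_aeval_eq_zero {S : Set (Fin n ⊕ Fin n → ℂ)}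
    (hS : IsIrreducibleClosed ℂ S) (hdim : zariskiDim ℂ S ≤ (2 : ℕ)) {p : ℕ → Fin n ⊕ Fin n → ℂ}
    (hpS : ∀ m, p m ∈ S) {f : MvPolynomial (Fin n ⊕ Fin n) ℂ} (hf : f ∉ vanishingIdeal ℂ S)
    (hfp : ∀ m, aeval (p m) f = 0) (a b : Fin n ⊕ Fin n) :
    ∃ H : Polynomial (Polynomial ℂ), H ≠ 0 ∧
      ∀ m, (H.map (Polynomial.evalRingHom (p m a))).eval (p m b) = 0 := by
  classical
  set I := vanishingIdeal ℂ (Set.range p) with hI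
  have hIS : vanishingIdeal ℂ S ≤ I :=
    vanishingIdeal_anti_mono (by rintro _ ⟨m, rfl⟩; exact hpS m)
  have hfI : f ∈ I := by
    rw [hI, mem_vanishingIdeal_iff]; rintro _ ⟨m, rfl⟩; exact hfp m
  have hpI : ∀ m, p m ∈ zeroLocus ℂ I := fun m =>
    (mem_zeroLocus_iff).2 fun g hg => (mem_vanishingIdeal_iff.1 hg) _ ⟨m, rfl⟩
  -- a relation on each component
  have hcomp : ∀ Q : Ideal (MvPolynomial (Fin n ⊕ Fin n) ℂ), Q ∈ I.minimalPrimes →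
      ∃ H : Polynomial (Polynomial ℂ), H ≠ 0 ∧
        (Polynomial.eval₂RingHom (Polynomial.eval₂RingHom
          (algebraMap ℂ (MvPolynomial (Fin n ⊕ Fin n) ℂ ⧸ Q))
          (Ideal.Quotient.mk _ (X a))) (Ideal.Quotient.mk _ (X b))) H = 0 := by
    intro Q hQ
    haveI : Q.IsPrime := hQ.1.1
    have hIQ : I ≤ Q := hQ.1.2
    have hdimQ := ringKrullDim_quotient_le_one hS hdim (hIS.trans hIQ) (hIQ hfI) hf
    set R := MvPolynomial (Fin n ⊕ Fin n) ℂ ⧸ Q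
    haveI : IsDomain R := Ideal.Quotient.isDomain _
    haveI : FaithfulSMul ℂ R := (faithfulSMul_iff_algebraMap_injective ℂ R).2 (algebraMap ℂ R).injective
    have htr : Algebra.trdeg ℂ R ≤ 1 := by
      have h := Literature.RingTheory.KrullDimension.ringKrullDim_eq_trdeg ℂ R
      rw [h] at hdimQ
      have hnat : Cardinal.toNat (Algebra.trdeg ℂ R) ≤ 1 := by exact_mod_cast hdimQ
      rw [Literature.RingTheory.KrullDimension.trdeg_eq_toNat ℂ R]
      exact_mod_cast hnat
    exact exists_polyPoly_relation_of_trdeg_le_one htr _ _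
  choose! Hc hHc0 hHc using hcomp
  have hfin := Ideal.finite_minimalPrimes_of_isNoetherianRing (MvPolynomial (Fin n ⊕ Fin n) ℂ) I
  refine ⟨∏ Q ∈ hfin.toFinset, Hc Q, ?_, fun m => ?_⟩
  · exact Finset.prod_ne_zero_iff.2 fun Q hQ => hHc0 Q (hfin.mem_toFinset.1 hQ)
  · obtain ⟨Q, hQ, hmQ⟩ := exists_minimalPrime_mem_zeroLocus (hpI m)
    rw [Polynomial.map_prod, Polynomial.eval_prod]
    exact Finset.prod_eq_zero (hfin.mem_toFinset.2 hQ)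
      (polyPoly_eval_eq_zero_of_mem_zeroLocus a b (hHc Q hQ) hmQ)

end Relation

/-! ## Theorem G′: density from non-clustering / rotation of a bounded multiplicative coordinate -/

section Rotation

variable {n : ℕ}

/-- **Theorem G′ (density from non-clustering).**  On an irreducible closed `S` of dimension `≤ 2`,
exponential points `p_m` with `‖x_{j₀}(p_m)‖ → ∞`, `‖y_{j₀}(p_m)‖ ≤ B` and `y_{j₀}(p_m)` clustering in
NO finite set are Zariski dense in `S`. [folklore] -/
theorem unprojectedDense_of_not_clusterIn {S : Set (Fin n ⊕ Fin n → ℂ)} (hS : IsIrreducibleClosed ℂ S)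
    (hdim : zariskiDim ℂ S ≤ (2 : ℕ)) (j₀ : Fin n) {p : ℕ → Fin n ⊕ Fin n → ℂ}
    (hpS : ∀ m, p m ∈ S) (hpΓ : ∀ m, p m ∈ expGraph ℂ n)
    (hx : Tendsto (fun m => ‖p m (Sum.inl j₀)‖) atTop atTop) {B : ℝ}
    (hB : ∀ m, ‖p m (Sum.inr j₀)‖ ≤ B)
    (hnc : ∀ Z : Finset ℂ, ¬ ClusterIn (fun m => p m (Sum.inr j₀)) Z) :
    UnprojectedDense S := by
  refine le_antisymm ?_ (vanishingIdeal_anti_mono Set.inter_subset_left)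
  intro f hf
  by_contra hfS
  have hfp : ∀ m, aeval (p m) f = 0 := fun m => (mem_vanishingIdeal_iff.1 hf) _ ⟨hpS m, hpΓ m⟩
  obtain ⟨H, hH0, hH⟩ := exists_polyPoly_relation_of_forall_aeval_eq_zero hS hdim hpS hfS hfp
    (Sum.inr j₀) (Sum.inl j₀)
  have hG : ∀ m, H.eval₂ (Polynomial.evalRingHom (p m (Sum.inr j₀))) (p m (Sum.inl j₀)) = 0 := by
    intro m; rw [← Polynomial.eval_map]; exact hH m
  have hlead := tendsto_norm_leadingCoeff_eval H (fun m => p m (Sum.inl j₀))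
    (fun m => p m (Sum.inr j₀)) hx hB hG
  exact hnc _ (clusterIn_roots_of_tendsto (Polynomial.leadingCoeff_ne_zero.2 hH0) hlead)

/-- **Theorem G′, rotation form** (seat 1's hypothesis set): exponential points `p_m` of `S` with
`‖x_{j₀}(p_m)‖ → ∞`, `0 < A ≤ ‖y_{j₀}(p_m)‖ ≤ B`, and some multiplicative difference of
`m ↦ y_{j₀}(p_m)` an exact non-periodic rotation `c₀ ζ^m` (`c₀ ≠ 0`, `|ζ| = 1`, `ζ` no root of unity)
are Zariski dense in `S`. [folklore] -/
theorem unprojectedDense_of_rotation {S : Set (Fin n ⊕ Fin n → ℂ)} (hS : IsIrreducibleClosed ℂ S)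
    (hdim : zariskiDim ℂ S ≤ (2 : ℕ)) (j₀ : Fin n) {p : ℕ → Fin n ⊕ Fin n → ℂ}
    (hpS : ∀ m, p m ∈ S) (hpΓ : ∀ m, p m ∈ expGraph ℂ n)
    (hx : Tendsto (fun m => ‖p m (Sum.inl j₀)‖) atTop atTop) {A B : ℝ} (hA : 0 < A)
    (hAB : ∀ m, A ≤ ‖p m (Sum.inr j₀)‖ ∧ ‖p m (Sum.inr j₀)‖ ≤ B) (k : ℕ) {c₀ ζ : ℂ} (hc₀ : c₀ ≠ 0)
    (hζ : ‖ζ‖ = 1) (hroot : ∀ j : ℕ, 0 < j → ζ ^ j ≠ 1)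
    (hrot : ∀ m, mulShift^[k] (fun m => p m (Sum.inr j₀)) m = c₀ * ζ ^ m) :
    UnprojectedDense S := by
  refine le_antisymm ?_ (vanishingIdeal_anti_mono Set.inter_subset_left)
  intro f hf
  by_contra hfS
  have hfp : ∀ m, aeval (p m) f = 0 := fun m => (mem_vanishingIdeal_iff.1 hf) _ ⟨hpS m, hpΓ m⟩
  obtain ⟨H, hH0, hH⟩ := exists_polyPoly_relation_of_forall_aeval_eq_zero hS hdim hpS hfS hfp
    (Sum.inr j₀) (Sum.inl j₀)
  have hG : ∀ m, H.eval₂ (Polynomial.evalRingHom (p m (Sum.inr j₀))) (p m (Sum.inl j₀)) = 0 := by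
    intro m; rw [← Polynomial.eval_map]; exact hH m
  exact hH0 (eq_zero_of_eval₂_eq_zero_of_rotation H (fun m => p m (Sum.inl j₀))
    (fun m => p m (Sum.inr j₀)) hx hA hAB k hc₀ hζ hroot hrot hG)

end Rotation

end Summit.Schanuel.Schanuel.Theorems
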